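import Mathlib
import Summits.Ventures.PercRepro2.HCov
import Summits.Ventures.PercRepro2.BHKAvoid
import Summits.Ventures.PercRepro2.BHKEvents
import Summits.Ventures.PercRepro2.ExploreA3
import Summits.Ventures.PercRepro2.RootLeafUSigns
import Summits.Ventures.PercRepro2.RootLeafUHalf
import Summits.Ventures.PercRepro2.RootLeafUOu
import Summits.Ventures.PercRepro2.RootLeafUClaimI
import Summits.Ventures.PercRepro2.RootLeafUKMaster
import Summits.Ventures.PercRepro2.RootLeafUMasterIdentity

/-!
# The `o ∈ L` half of the second root-leaf coefficient, cleared by `W = P(u ↮ {a₂, c})`: the exact identity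
`W·T2oL = P(R,oL)·(OU) + (κ − α)·δ + 2β·(b)_L + 2β·(c)_L` and the reduction `0 ≤ T2oL ⟸ 0 ≤ K3L` for EVERY
instance (blind cell PercRepro2, p4 g25; S3 (G4-u), proofs/P4-G25-KSIDE.md §6) — the mirror of RootLeafUKSide.

With `R = PD ⊔ T = {u ↮ a₂, u ↮ c}`, `W = P(R) = D + t`, `oL = {u ↔ o}`, `bL = {u ↔ b}`, `(OU) = T2oL(o := u)` written out
(`A·D + 2α·t + 2β·P(T,bL) − 2β·P(R,bK)`, `0 ≤ (OU)` is `T2oL_root_nonneg` via `T2oL_root_eq`), `A = κ + α`, `β = D + d0·Z`: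

* **`W_mul_T2oL_eq`**: `W·T2oL = P(R,oL)·(OU) + (κ − α)·δ + 2β·(b)_L + 2β·(c)_L` — a `ring` identity after the Q-splits — with
  `δ = t·P(PD,oL) − D·P(T,oL)` (`0 ≤ δ` is `ToL_mul_D_le`, BHK06 1.4 on `R`),
  `(b)_L = W·P(T,oL,bL) − P(R,oL)·P(T,bL)` (of BOTH signs), `(c)_L = P(R,oL)·P(R,bK) − W·P(R,oL,bK)` (`cL_nonneg`, BHK06 1.4
  on `R` with `{o ∈ L}` against `{b ∈ K}`), and `0 ≤ κ − α` (`KMaster.kappa_sub_alpha_nonneg`);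
* hence **`T2oL_nonneg_of_K3L`**: `0 ≤ K3L := P(R,oL)·(OU) + (κ − α)·δ + 2β·(b)_L → 0 ≤ T2oL` for every finite graph and
  weight vector (`W = 0` forces every `PD`- and `T`-mass to vanish and `T2oL = 0`).  Unlike the `o ∈ K` half, the `o ∈ L`
  half has an o-free core `(OU) ≥ 0`, and it is load-bearing: the mirror of the K side's `K3` (without the `(OU)`-term)
  fails in census (26 / 500), while `K3L ≥ 0` is census-true (0 / 1,000) — it replaces (an)'s hypothesis `0 ≤ B1`
  (`T2oL_nonneg_of_B1`), which is false in general.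
-/

namespace Summit.Ventures.PercRepro2

open UnionCluster CovForm

namespace RootLeafU

namespace LSide

variable {V : Type*} {E : Type*} [Fintype E] [DecidableEq E] [Fintype V] [DecidableEq V]
  {R : Type*} [Field R] [LinearOrder R] [IsStrictOrderedRing R]

variable (p : E → R) (ends : E → Sym2 V) (o a₂ c b u : V)

omit [Fintype V] in
/-- **The `W`-identity of the `o ∈ L` half**: `W·T2oL = P(R,oL)·(OU) + (κ − α)·δ + 2β·(b)_L + 2β·(c)_L`. -/
theorem W_mul_T2oL_eq :
    (prob p (PDEvent ends u a₂ c) + prob p (TEvent ends u a₂ c)) * T2oL p ends o a₂ c b u =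
      (prob p (PDEvent ends u a₂ c ∩ connEvent ends u o) + prob p (TEvent ends u a₂ c ∩ connEvent ends u o)) * (((prob p (PDEvent ends u a₂ c) * prob p (connEvent ends a₂ b) + prob p (avoidAll ends a₂ {c}) * gap p ends u a₂ b) + (prob p Set.univ * EQb3 p ends u a₂ c b + prob p Set.univ * PDb p ends u a₂ c b + prob p (connEvent ends a₂ b) * EQ3 p ends u a₂ c + prob p (connEvent ends a₂ b) * prob p (avoidAll ends a₂ {u}) - (prob p Set.univ - prob p (avoidAll ends a₂ {c})) * gap p ends u a₂ b)) * prob p (PDEvent ends u a₂ c) + 2 * (prob p (PDEvent ends u a₂ c) * prob p (connEvent ends a₂ b) + prob p (avoidAll ends a₂ {c}) * gap p ends u a₂ b) * prob p (TEvent ends u a₂ c) + 2 * (prob p Set.univ * prob p (PDEvent ends u a₂ c) + prob p (avoidAll ends a₂ {c}) * prob p (avoidAll ends a₂ {u})) * prob p (TEvent ends u a₂ c ∩ connEvent ends u b) - 2 * (prob p Set.univ * prob p (PDEvent ends u a₂ c) + prob p (avoidAll ends a₂ {c}) * prob p (avoidAll ends a₂ {u})) * (prob p (PDEvent ends u a₂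 c ∩ connEvent ends a₂ b) + prob p (TEvent ends u a₂ c ∩ connEvent ends a₂ b))) + ((prob p Set.univ * EQb3 p ends u a₂ c b + prob p Set.univ * PDb p ends u a₂ c b + prob p (connEvent ends a₂ b) * EQ3 p ends u a₂ c + prob p (connEvent ends a₂ b) * prob p (avoidAll ends a₂ {u}) - (prob p Set.univ - prob p (avoidAll ends a₂ {c})) * gap p ends u a₂ b) - (prob p (PDEvent ends u a₂ c) * prob p (connEvent ends a₂ b) + prob p (avoidAll ends a₂ {c}) * gap p ends u a₂ b)) * (prob p (TEvent ends u a₂ c) * prob p (PDEvent ends u a₂ c ∩ connEvent ends u o) - prob p (PDEvent ends u a₂ c) * prob p (TEvent ends u a₂ c ∩ connEvent ends u o)) + 2 * (prob p Set.univ * prob p (PDEvent ends u a₂ c) + prob p (avoidAll ends a₂ {c}) * prob p (avoidAll ends a₂ {u})) * ((prob p (PDEvent ends u a₂ c) + prob p (TEvent ends u a₂ c)) * prob p (TEvent ends u a₂ c ∩ (connEvent ends u o ∩ connEvent ends u b)) - (prob p (PDEvent ends u a₂ c ∩ connEvent ends u o) + prob p (TEvent ends u a₂ c ∩ connEvent ends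 u o)) * prob p (TEvent ends u a₂ c ∩ connEvent ends u b)) + 2 * (prob p Set.univ * prob p (PDEvent ends u a₂ c) + prob p (avoidAll ends a₂ {c}) * prob p (avoidAll ends a₂ {u})) * ((prob p (PDEvent ends u a₂ c ∩ connEvent ends u o) + prob p (TEvent ends u a₂ c ∩ connEvent ends u o)) * (prob p (PDEvent ends u a₂ c ∩ connEvent ends a₂ b) + prob p (TEvent ends u a₂ c ∩ connEvent ends a₂ b)) - (prob p (PDEvent ends u a₂ c) + prob p (TEvent ends u a₂ c)) * (prob p (PDEvent ends u a₂ c ∩ (connEvent ends u o ∩ connEvent ends a₂ b)) + prob p (TEvent ends u a₂ c ∩ (connEvent ends u o ∩ connEvent ends a₂ b)))) := by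
  have hZ := Qsplit_univ p ends u a₂ c
  have hbK := Qsplit p ends u a₂ c (connEvent ends a₂ b)
  have hbL := Qsplit p ends u a₂ c (connEvent ends u b)
  have hgap := gap_eq_Q p ends u a₂ b
  unfold T2oL EQb3 PDb EQ3
  rw [hgap, hZ, hbK, hbL, prob_univ]
  ring

omit [Fintype E] [DecidableEq E] [Fintype V] [LinearOrder R] [IsStrictOrderedRing R] in
/-- `{u ↔ o} ∩ {a₂ ↔ b} ∩ {u ↮ {a₂, c}} = R ∩ ({u ↔ o} ∩ {a₂ ↔ b})`. -/
lemma oL_bK_avoid_eq : connEvent ends u o ∩ connEvent ends a₂ b ∩ avoidAll ends u {a₂, c} =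
    avoidAll ends u {a₂, c} ∩ (connEvent ends u o ∩ connEvent ends a₂ b) := by
  ext ω
  simp only [Set.mem_inter_iff]
  tauto

/-- **`0 ≤ (c)_L`**: `W·P(R,oL,bK) ≤ P(R,oL)·P(R,bK)` — BHK06 Thm 1.4 on `R` (`{o ∈ L}` against `{b ∈ K}`). -/
theorem cL_nonneg (hp : IsProbVec p) : 0 ≤ ((prob p (PDEvent ends u a₂ c ∩ connEvent ends u o) + prob p (TEvent ends u a₂ c ∩ connEvent ends u o)) * (prob p (PDEvent ends u a₂ c ∩ connEvent ends a₂ b) + prob p (TEvent ends u a₂ c ∩ connEvent ends a₂ b)) - (prob p (PDEvent ends u a₂ c) + prob p (TEvent ends u a₂ c)) * (prob p (PDEvent ends u a₂ c ∩ (connEvent ends u o ∩ connEvent ends a₂ b)) + prob p (TEvent ends u a₂ c ∩ (connEvent ends u o ∩ connEvent ends a₂ b)))) := by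
  classical
  have h := bhk_cross_cluster_avoid p hp ends u a₂ (X := {a₂, c}) (Finset.mem_insert_self a₂ {c})
    (isUpperSet_mem_setOf o) (isUpperSet_mem_setOf b)
  rw [← connEvent_eq_clusterInEvent ends u o, ← connEvent_eq_clusterInEvent ends a₂ b, oL_bK_avoid_eq,
    Set.inter_comm (connEvent ends u o) (avoidAll ends u {a₂, c}),
    Set.inter_comm (connEvent ends a₂ b) (avoidAll ends u {a₂, c}),
    ← ISplit.prob_PD_add_T p ends u a₂ c (connEvent ends u o ∩ connEvent ends a₂ b),
    ← ISplit.prob_PD_add_T p ends u a₂ c (connEvent ends u o),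
    ← ISplit.prob_PD_add_T p ends u a₂ c (connEvent ends a₂ b)] at h
  have hW : prob p (avoidAll ends u {a₂, c}) = prob p (PDEvent ends u a₂ c) + prob p (TEvent ends u a₂ c) := by
    have h' := ISplit.prob_PD_add_T p ends u a₂ c Set.univ
    simpa only [Set.inter_univ] using h'.symm
  rw [hW] at h
  linarith [h]

/-- **`0 ≤ T2oL` on every instance with `0 ≤ K3L := P(R,oL)·(OU) + (κ − α)·δ + 2β·(b)_L`**: `W·T2oL = K3L + 2β·(c)_L ≥ 0`,
so `T2oL ≥ 0` when `W > 0`; when `W = 0` every `PD`- and `T`-mass vanishes and `T2oL = 0`. -/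
theorem T2oL_nonneg_of_K3L (hp : IsProbVec p) (hK : 0 ≤ ((prob p (PDEvent ends u a₂ c ∩ connEvent ends u o) + prob p (TEvent ends u a₂ c ∩ connEvent ends u o)) * (((prob p (PDEvent ends u a₂ c) * prob p (connEvent ends a₂ b) + prob p (avoidAll ends a₂ {c}) * gap p ends u a₂ b) + (prob p Set.univ * EQb3 p ends u a₂ c b + prob p Set.univ * PDb p ends u a₂ c b + prob p (connEvent ends a₂ b) * EQ3 p ends u a₂ c + prob p (connEvent ends a₂ b) * prob p (avoidAll ends a₂ {u}) - (prob p Set.univ - prob p (avoidAll ends a₂ {c})) * gap p ends u a₂ b)) * prob p (PDEvent ends u a₂ c) + 2 * (prob p (PDEvent ends u a₂ c) * prob p (connEvent ends a₂ b) + prob p (avoidAll ends a₂ {c}) * gap p ends u a₂ b) * prob p (TEvent ends u a₂ c) + 2 * (prob p Set.univ * prob p (PDEvent ends u a₂ c) + prob p (avoidAll ends a₂ {c}) * prob p (avoidAll ends a₂ {u})) * prob p (TEvent ends u a₂ c ∩ connEvent ends u b) - 2 * (prob p Set.univ * prob p (PDEvent ends u a₂ c) + prob p (avoidAll ends a₂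 {c}) * prob p (avoidAll ends a₂ {u})) * (prob p (PDEvent ends u a₂ c ∩ connEvent ends a₂ b) + prob p (TEvent ends u a₂ c ∩ connEvent ends a₂ b))) + ((prob p Set.univ * EQb3 p ends u a₂ c b + prob p Set.univ * PDb p ends u a₂ c b + prob p (connEvent ends a₂ b) * EQ3 p ends u a₂ c + prob p (connEvent ends a₂ b) * prob p (avoidAll ends a₂ {u}) - (prob p Set.univ - prob p (avoidAll ends a₂ {c})) * gap p ends u a₂ b) - (prob p (PDEvent ends u a₂ c) * prob p (connEvent ends a₂ b) + prob p (avoidAll ends a₂ {c}) * gap p ends u a₂ b)) * (prob p (TEvent ends u a₂ c) * prob p (PDEvent ends u a₂ c ∩ connEvent ends u o) - prob p (PDEvent ends u a₂ c) * prob p (TEvent ends u a₂ c ∩ connEvent ends u o)) + 2 * (prob p Set.univ * prob p (PDEvent ends u a₂ c) + prob p (avoidAll ends a₂ {c}) * prob p (avoidAll ends a₂ {u})) * ((prob p (PDEvent ends u a₂ c) + prob p (TEvent ends u a₂ c)) * prob p (TEvent ends u a₂ c ∩ (connEvent ends u o ∩ connEvent ends u b)) - (prob p (PDEvent ends u a₂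 c ∩ connEvent ends u o) + prob p (TEvent ends u a₂ c ∩ connEvent ends u o)) * prob p (TEvent ends u a₂ c ∩ connEvent ends u b)))) : 0 ≤ T2oL p ends o a₂ c b u := by
  classical
  have key := W_mul_T2oL_eq p ends o a₂ c b u
  have hc := cL_nonneg p ends o a₂ c b u hp
  have n_D := prob_nonneg hp (PDEvent ends u a₂ c)
  have n_t := prob_nonneg hp (TEvent ends u a₂ c)
  have n_d0 := prob_nonneg hp (avoidAll ends a₂ {c})
  have n_Z := prob_nonneg hp (avoidAll ends a₂ {u})
  have n_β : 0 ≤ (prob p Set.univ * prob p (PDEvent ends u a₂ c) + prob p (avoidAll ends a₂ {c}) * prob p (avoidAll ends a₂ {u})) := by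
    rw [prob_univ]
    nlinarith [mul_nonneg n_d0 n_Z]
  rcases eq_or_lt_of_le (add_nonneg n_D n_t) with hW0 | hWpos
  · -- `W = 0`: `D = t = 0`, every `PD`- and `T`-mass vanishes, `T2oL = 0`
    have hD : prob p (PDEvent ends u a₂ c) = 0 := by linarith
    have ht : prob p (TEvent ends u a₂ c) = 0 := by linarith
    have z : ∀ X : Set (Config E), prob p (PDEvent ends u a₂ c ∩ X) = 0 :=
      fun X => le_antisymm (hD ▸ prob_mono hp Set.inter_subset_left) (prob_nonneg hp _)
    have z' : ∀ X : Set (Config E), prob p (TEvent ends u a₂ c ∩ X) = 0 :=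
      fun X => le_antisymm (ht ▸ prob_mono hp Set.inter_subset_left) (prob_nonneg hp _)
    unfold T2oL
    rw [z, z', z', z, z']
    simp only [mul_zero, sub_zero, add_zero]
    exact le_refl _
  · have hpos : 0 ≤ (prob p (PDEvent ends u a₂ c) + prob p (TEvent ends u a₂ c)) * T2oL p ends o a₂ c b u := by
      rw [key]
      have h1 : 0 ≤ 2 * (prob p Set.univ * prob p (PDEvent ends u a₂ c) + prob p (avoidAll ends a₂ {c}) * prob p (avoidAll ends a₂ {u})) * ((prob p (PDEvent ends u a₂ c ∩ connEvent ends u o) + prob p (TEvent ends u a₂ c ∩ connEvent ends u o)) * (prob p (PDEvent ends u a₂ c ∩ connEvent ends a₂ b) + prob p (TEvent ends u a₂ c ∩ connEvent ends a₂ b)) - (prob p (PDEvent ends u a₂ c) + prob p (TEvent ends u a₂ c)) * (prob p (PDEvent ends u a₂ c ∩ (connEvent ends u o ∩ connEvent ends a₂ b)) + prob p (TEvent ends u a₂ c ∩ (connEvent ends u o ∩ connEvent ends a₂ b)))) := mul_nonneg (mul_nonneg (by norm_num) n_β) hc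
      linarith
    by_contra hneg
    have := mul_neg_of_pos_of_neg hWpos (not_le.mp hneg)
    linarith

end LSide

end RootLeafU

end Summit.Ventures.PercRepro2
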